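/-
COR-CM (cell pub-hodgecm2, stage 2 of the Hodge ladder) — count-neutral KERNEL SYMMETRY of the displayed B01 leaves B01-C
`FaceSeesawCoupling` / B01-O `FaceWedgeOverlap` (`CorCM/B01/FaceSkeleton.lean`, `CorCM/B01/FaceInputsSplit.lean`): the DUAL FACE,
part 2 of 2 (part 1 = `CorCM/FacePeriodDuality.lean`).  Seat prover-pub-hodgecm2-b07-g32-0 (binder prover b07, gen 32; claim
FACE-DUAL, HOME/lit/LIT-STATUS.md 2026-08-21T08:45Z).  Theorems only; no definition, no named fact, nothing asserted; nothing under
`CorCM/B01/` is edited (its declarations are imported BY NAME); `Interfaces.lean` (C1) untouched.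
-/
import Summits.HodgeConjecture.CorCM.FacePeriodDuality
import Summits.HodgeConjecture.CorCM.B01.FaceInputsSplit
import HarnessLib

/-!
# The coupling / overlap leaves of B01 are needed at one orientation per square

`CorCM/FacePeriodDuality.lean`: the dual face `f^∨ = (Φ^{(π)}; π, π′)` of `f = (Φ; π, π′)` exchanges the (12)- and (34)-pairs of
period types (the two diagonals of the type square), keeps the admissible embeddings, and the face-form period statement is
invariant: `U.PeriodNV ι₁ V F f.dual.psi σ ↔ U.PeriodNV ι₁ V F f.psi σ` on every universe with `Fact_cup_comm1`,
`Fact_cup_interchange`.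

Consequence for the split of record `Model.perLFace_of_PerL_of_supply_heckeWedge10_overlap` (B01 ⇐ B01-S ∧ B01-H ∧ B01-O) and for
`perLFace_of_PerL_of_faceInputs` (B01 ⇐ B01-L ∧ B01-C): the supply / line-field / wedge leaves are orientation-blind, and the
COUPLING leaf is consumed, square by square, only at the orientation at which the period is finally read.  So for any selector `π`
of faces with `π f ∨ π f.dual`:

* `Universe.periodThmF_of_faceLineField_of_orientedCoupling` — B01-L with B01-C AT THE π-FACES ONLY gives `PeriodThmF`
  (`Fact_pull_comp`, `Fact_cup_comm1`, `Fact_cup_interchange`);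
* `Universe.coupling_of_wedgeOverlap_at` — the pointwise content of own-b01's `faceSeesawCoupling_of_wedgeOverlap` (one face datum:
  HR (2,0) on the non-zero overlap class, expansion of both slots of the pairing);
* `Universe.periodThmF_of_supply_heckeWedge10_orientedOverlap` and, on the universe of record,
  **`Model.perLFace_of_PerL_of_supply_heckeWedge10_orientedOverlap : … → PerLFace_of_PerL`** — B01 BY NAME from B01-S, B01-H and
  B01-O demanded at the π-faces only (definition-free: the body of `FaceWedgeOverlap` with `π f →` inserted);
* `Model.perLFace_of_PerL_of_supply_heckeWedge10_overlap_sqStable` — the degree-6 selector: at sextic fields B01-O is demanded only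
  at faces with a `σ²`-STABLE (12)-slot type (`Face.sq_stable_slot_lt_two_or_dual`), i.e. WLOG the type induced from the
  imaginary quadratic subfield — whose `A_{(F,ψ)}` is isogenous to the cube of a CM elliptic curve — is integrated UNconjugated.

Nothing displayed changes; whether B01-C / B01-O are re-cut per square is the call of the owner of `CorCM/B01/`.

References: rfwf v3 Def. 1.1 / §4.2; PerL v5 Thm 3.7 (`S₁₂ = S₃₄`) and Thm 4.4; P. Deligne, *Théorie de Hodge II*, 2.1.4.
-/

noncomputable section

open scoped TensorProduct
open NumberField
open Literature.AlgebraicGeometry.Motives (CMType HodgeStructure)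
open Literature.AlgebraicGeometry.Motives.HodgeStructure (conj)
open Literature.AlgebraicGeometry.HodgeTheory
open Literature.NumberTheory.Automorphic.PicardCM
open Literature.NumberTheory.Automorphic.PicardCM.CMCode (cmTypeMap)

namespace Summit.HodgeConjecture.CorCM

namespace Universe

variable {U : Universe}

/-! ## §1  B01-L with B01-C at the selected faces; B01-O at the selected faces -/

/-- **B01-L with B01-C AT THE SELECTED FACES gives `PeriodThmF`** (`Fact_pull_comp`, `Fact_cup_comm1`, `Fact_cup_interchange`):
the hypothesis `hC` is the body of `FaceSeesawCoupling` with `π f →` inserted; at a non-selected face the period theorem is read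
off the dual face. -/
theorem periodThmF_of_faceLineField_of_orientedCoupling (hc : U.Fact_pull_comp) (h1 : U.Fact_cup_comm1)
    (h2 : U.Fact_cup_interchange) (π : ∀ ⦃F : CMField⦄, Face F → Prop) (hπ : ∀ ⦃F : CMField⦄ (f : Face F), π f ∨ π f.dual)
    (hL : U.FaceLineField)
    (hC : ∀ (F : CMField), IsGalois ℚ F → 6 ≤ Module.finrank ℚ F → ∀ (f : Face F), π f →
      ∀ (ι₁ : F →+* ℂ), f.Admissible ι₁ →
      ∀ (V : HermSpace3 F ι₁) (Γ : Level V) (ω₀ ω₁ : U.CohC (U.pms F ι₁ V Γ) 1),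
        ω₀ ∈ U.Uiso Γ F (f.psi 0) ι₁ → ω₁ ∈ U.Uiso Γ F (f.psi 1) ι₁ →
        U.cup2C (U.pms F ι₁ V Γ) 1 ω₀ ω₁ ≠ 0 →
          ∃ (Γ' : Level V) (g : U.Mor (U.pms F ι₁ V Γ') (U.pms F ι₁ V Γ))
            (ω₂ ω₃ : U.CohC (U.pms F ι₁ V Γ') 1),
            ω₂ ∈ U.Uiso Γ' F (f.psi 2) ι₁ ∧ ω₃ ∈ U.Uiso Γ' F (f.psi 3) ι₁ ∧
              U.period (U.pms F ι₁ V Γ') ![U.pullC g 1 ω₀, U.pullC g 1 ω₁, ω₂, ω₃] ≠ 0) :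
    U.PeriodThmF :=
  periodThmF_of_oriented h1 h2 π hπ fun F hG h6 f hf ι₁ hι V => by
    obtain ⟨Γ, ω₀, ω₁, h₀, h₁', hne⟩ := hL F hG h6 f ι₁ hι V
    obtain ⟨Γ', g, ω₂, ω₃, h₂, h₃, hper⟩ := hC F hG h6 f hf ι₁ hι V Γ ω₀ ω₁ h₀ h₁' hne
    exact periodNV_of_coupled_levels hc g h₀ h₁' h₂ h₃ hper

/-- The sesquilinear pairing `⟨y, z⟩ := tr(y ∪ conj z)` on `H²(P, ℂ)` is additive in `z`. -/
private theorem pairing_conj_add' (X : U.Var) (y z z' : U.CohC X 2) :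
    U.trC X 4 (U.cup2C X 2 y (conj (z + z'))) =
      U.trC X 4 (U.cup2C X 2 y (conj z)) + U.trC X 4 (U.cup2C X 2 y (conj z')) := by
  rw [map_add, map_add, map_add]

/-- The pairing `⟨y, z⟩ := tr(y ∪ conj z)` is conjugate-homogeneous in `z`. -/
private theorem pairing_conj_smul' (X : U.Var) (y z : U.CohC X 2) (c : ℂ) :
    U.trC X 4 (U.cup2C X 2 y (conj (c • z))) = starRingEnd ℂ c * U.trC X 4 (U.cup2C X 2 y (conj z)) := by
  rw [HodgeStructure.conj_smul, map_smul, map_smul, smul_eq_mul]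

/-- **Overlap ⇒ coupling, one face datum at a time** (the pointwise content of own-b01's
`faceSeesawCoupling_of_wedgeOverlap`: HR on the non-zero overlap class, expansion of the left slot over the translates and of the
right slot over the pure (34)-wedges). -/
theorem coupling_of_wedgeOverlap_at (hH : U.Fact_pull_hodge) (hcup2 : U.Fact_cup2_hodge) (hpc : U.Fact_pull_cup)
    (hHR : ∀ {L : CMField} {ι₁ : L →+* ℂ} {V : HermSpace3 L ι₁} (Γ : Level V) (η : U.CohC (U.pms L ι₁ V Γ) 2),
      η ∈ (U.hodge (U.pms L ι₁ V Γ) 2).F 2 → η ≠ 0 → U.trC (U.pms L ι₁ V Γ) 4 (U.cup2C (U.pms L ι₁ V Γ) 2 η (conj η)) ≠ 0)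
    {F : CMField} (f : Face F) {ι₁ : F →+* ℂ} {V : HermSpace3 F ι₁} {Γ : Level V} {ω₀ ω₁ : U.CohC (U.pms F ι₁ V Γ) 1}
    (hO : ∃ (Γ' : Level V) (x : U.CohC (U.pms F ι₁ V Γ') 2), x ≠ 0 ∧
      x ∈ U.heckeSpan Γ' Γ (U.cup2C (U.pms F ι₁ V Γ) 1 ω₀ ω₁) ∧ x ∈ U.wedgeSpan Γ' F (f.psi 2) (f.psi 3) ι₁) :
    ∃ (Γ' : Level V) (g : U.Mor (U.pms F ι₁ V Γ') (U.pms F ι₁ V Γ)) (ω₂ ω₃ : U.CohC (U.pms F ι₁ V Γ') 1),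
      ω₂ ∈ U.Uiso Γ' F (f.psi 2) ι₁ ∧ ω₃ ∈ U.Uiso Γ' F (f.psi 3) ι₁ ∧
        U.period (U.pms F ι₁ V Γ') ![U.pullC g 1 ω₀, U.pullC g 1 ω₁, ω₂, ω₃] ≠ 0 := by
  obtain ⟨Γ', x, hx0, hxE, hxW⟩ := hO
  have hxF : x ∈ (U.hodge (U.pms F ι₁ V Γ') 2).F 2 := by
    refine (Submodule.span_le.mpr ?_) hxW
    rintro y ⟨ω₂, ω₃, h₂, h₃, rfl⟩
    exact cup2C_mem_F_two_of_Uiso hH hcup2 Γ' F (f.psi 2) (f.psi 3) ι₁ h₂ h₃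
  have hxx : U.trC _ 4 (U.cup2C _ 2 x (conj x)) ≠ 0 := hHR Γ' x hxF hx0
  obtain ⟨y, ⟨g, rfl⟩, hy⟩ := exists_mem_ne_zero_of_span (φ := fun y => U.trC _ 4 (U.cup2C _ 2 y (conj x)))
    (fun y y' => by simp only [map_add, LinearMap.add_apply])
    (fun c y => ⟨c, by simp only [map_smul, LinearMap.smul_apply, smul_eq_mul]⟩) hxE hxx
  obtain ⟨z, ⟨ω₂, ω₃, h₂, h₃, rfl⟩, hz⟩ :=
    exists_mem_ne_zero_of_span (φ := fun z => U.trC _ 4 (U.cup2C _ 2 (U.pullC g 2 (U.cup2C _ 1 ω₀ ω₁)) (conj z)))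
      (fun z z' => pairing_conj_add' _ _ z z') (fun c z => ⟨starRingEnd ℂ c, pairing_conj_smul' _ _ z c⟩) hxW hy
  refine ⟨Γ', g, ω₂, ω₃, h₂, h₃, ?_⟩
  rw [period_eq_pairing_wedges]
  simp only [Matrix.cons_val_zero, Matrix.cons_val_one, Matrix.cons_val]
  have hg : U.pullC g 2 (U.cup2C (U.pms F ι₁ V Γ) 1 ω₀ ω₁) =
      U.cup2C (U.pms F ι₁ V Γ') 1 (U.pullC g 1 ω₀) (U.pullC g 1 ω₁) := pullC_cup2C hpc g 1 ω₀ ω₁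
  rw [hg] at hz
  exact hz

/-- **B01-O AT THE SELECTED FACES with B01-S and the wedge input gives `PeriodThmF`** (any universe with the PerL-cone facts,
HR (2,0) on its Picard modular surfaces, and `Fact_cup_comm1`/`Fact_cup_interchange`): the hypothesis `hO` is the body of
`FaceWedgeOverlap` with `π f →` inserted. -/
theorem periodThmF_of_supply_heckeWedge10_orientedOverlap (hc : U.Fact_pull_comp) (hH : U.Fact_pull_hodge)
    (hcup2 : U.Fact_cup2_hodge) (hpc : U.Fact_pull_cup) (h1 : U.Fact_cup_comm1) (h2 : U.Fact_cup_interchange)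
    (hHR : ∀ {L : CMField} {ι₁ : L →+* ℂ} {V : HermSpace3 L ι₁} (Γ : Level V) (η : U.CohC (U.pms L ι₁ V Γ) 2),
      η ∈ (U.hodge (U.pms L ι₁ V Γ) 2).F 2 → η ≠ 0 → U.trC (U.pms L ι₁ V Γ) 4 (U.cup2C (U.pms L ι₁ V Γ) 2 η (conj η)) ≠ 0)
    (π : ∀ ⦃F : CMField⦄, Face F → Prop) (hπ : ∀ ⦃F : CMField⦄ (f : Face F), π f ∨ π f.dual)
    (hS : U.FaceSupply) (hW : U.HeckeWedge10)
    (hO : ∀ (F : CMField), IsGalois ℚ F → 6 ≤ Module.finrank ℚ F → ∀ (f : Face F), π f →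
      ∀ (ι₁ : F →+* ℂ), f.Admissible ι₁ →
      ∀ (V : HermSpace3 F ι₁) (Γ : Level V) (ω₀ ω₁ : U.CohC (U.pms F ι₁ V Γ) 1),
        ω₀ ∈ U.Uiso Γ F (f.psi 0) ι₁ → ω₁ ∈ U.Uiso Γ F (f.psi 1) ι₁ →
        U.cup2C (U.pms F ι₁ V Γ) 1 ω₀ ω₁ ≠ 0 →
          ∃ (Γ' : Level V) (x : U.CohC (U.pms F ι₁ V Γ') 2), x ≠ 0 ∧
            x ∈ U.heckeSpan Γ' Γ (U.cup2C (U.pms F ι₁ V Γ) 1 ω₀ ω₁) ∧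
            x ∈ U.wedgeSpan Γ' F (f.psi 2) (f.psi 3) ι₁) :
    U.PeriodThmF :=
  periodThmF_of_faceLineField_of_orientedCoupling hc h1 h2 π hπ (faceLineField_of_supply_of_heckeWedge10 hc hH hS hW)
    fun F hG h6 f hf ι₁ hι V Γ ω₀ ω₁ h₀ h₁' hne =>
      coupling_of_wedgeOverlap_at hH hcup2 hpc hHR f (hO F hG h6 f hf ι₁ hι V Γ ω₀ ω₁ h₀ h₁' hne)
end Universe

/-! ## §2  The universe of record: B01 by name from the leaves at one orientation per square -/

namespace Model

/-- **Binder B01 BY NAME from B01-L and B01-C AT ONE ORIENTATION PER SQUARE** (the first split of record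
`perLFace_of_PerL_of_faceInputs` with its coupling leaf `FaceSeesawCoupling` weakened to the faces selected by any `π` with
`π f ∨ π f.dual`; definition-free: the leaf body with `π f →` inserted).  `U.PerL` idle. -/
theorem perLFace_of_PerL_of_faceLineField_orientedCoupling
    (π : ∀ ⦃F : CMField⦄, Face F → Prop) (hπ : ∀ ⦃F : CMField⦄ (f : Face F), π f ∨ π f.dual)
    (hL : ∀ (hHD : exists_isReal_hodgeModel) (hI : hodgePQ_independent_of_hodgeModel)
      (h₁ : BallQuotientUniformised) (h₃ : CMAbelianVarietyRealised), (picardCMUniverse hHD hI h₁ h₃).FaceLineField)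
    (hC : ∀ (hHD : exists_isReal_hodgeModel) (hI : hodgePQ_independent_of_hodgeModel)
      (h₁ : BallQuotientUniformised) (h₃ : CMAbelianVarietyRealised),
      ∀ (F : CMField), IsGalois ℚ F → 6 ≤ Module.finrank ℚ F → ∀ (f : Face F), π f →
      ∀ (ι₁ : F →+* ℂ), f.Admissible ι₁ →
      ∀ (V : HermSpace3 F ι₁) (Γ : Level V)
        (ω₀ ω₁ : (picardCMUniverse hHD hI h₁ h₃).CohC ((picardCMUniverse hHD hI h₁ h₃).pms F ι₁ V Γ) 1),
        ω₀ ∈ (picardCMUniverse hHD hI h₁ h₃).Uiso Γ F (f.psi 0) ι₁ →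
        ω₁ ∈ (picardCMUniverse hHD hI h₁ h₃).Uiso Γ F (f.psi 1) ι₁ →
        (picardCMUniverse hHD hI h₁ h₃).cup2C ((picardCMUniverse hHD hI h₁ h₃).pms F ι₁ V Γ) 1 ω₀ ω₁ ≠ 0 →
          ∃ (Γ' : Level V) (g : (picardCMUniverse hHD hI h₁ h₃).Mor ((picardCMUniverse hHD hI h₁ h₃).pms F ι₁ V Γ')
              ((picardCMUniverse hHD hI h₁ h₃).pms F ι₁ V Γ))
            (ω₂ ω₃ : (picardCMUniverse hHD hI h₁ h₃).CohC ((picardCMUniverse hHD hI h₁ h₃).pms F ι₁ V Γ') 1),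
            ω₂ ∈ (picardCMUniverse hHD hI h₁ h₃).Uiso Γ' F (f.psi 2) ι₁ ∧
              ω₃ ∈ (picardCMUniverse hHD hI h₁ h₃).Uiso Γ' F (f.psi 3) ι₁ ∧
              (picardCMUniverse hHD hI h₁ h₃).period ((picardCMUniverse hHD hI h₁ h₃).pms F ι₁ V Γ')
                ![(picardCMUniverse hHD hI h₁ h₃).pullC g 1 ω₀, (picardCMUniverse hHD hI h₁ h₃).pullC g 1 ω₁, ω₂, ω₃] ≠ 0) :
    PerLFace_of_PerL :=
  fun hHD hI h₁ h₃ _ =>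
    Universe.periodThmF_of_faceLineField_of_orientedCoupling
      (universeOf_fact_pull_comp hHD hI (ballQuotientUniformisedDatum_of h₁) h₃)
      (picardCMUniverse_modelAxioms hHD hI h₁ h₃).cup_comm1 (picardCMUniverse_modelAxioms hHD hI h₁ h₃).cup_interchange
      π hπ (hL hHD hI h₁ h₃) (hC hHD hI h₁ h₃)

/-- **Binder B01 BY NAME from supply, the holomorphic Hecke wedge, and the wedge overlap AT ONE ORIENTATION PER SQUARE.**
The split of record `perLFace_of_PerL_of_supply_heckeWedge10_overlap` with its third leaf B01-O `FaceWedgeOverlap` weakened to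
the faces selected by any `π` with `π f ∨ π f.dual` (definition-free: the leaf body with `π f →` inserted); all cone facts, HR (2,0)
and the cup-product rows are tree theorems on the model.  `U.PerL` idle. -/
theorem perLFace_of_PerL_of_supply_heckeWedge10_orientedOverlap
    (π : ∀ ⦃F : CMField⦄, Face F → Prop) (hπ : ∀ ⦃F : CMField⦄ (f : Face F), π f ∨ π f.dual)
    (hS : ∀ (hHD : exists_isReal_hodgeModel) (hI : hodgePQ_independent_of_hodgeModel)
      (h₁ : BallQuotientUniformised) (h₃ : CMAbelianVarietyRealised), (picardCMUniverse hHD hI h₁ h₃).FaceSupply)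
    (hW : ∀ (hHD : exists_isReal_hodgeModel) (hI : hodgePQ_independent_of_hodgeModel)
      (h₁ : BallQuotientUniformised) (h₃ : CMAbelianVarietyRealised), (picardCMUniverse hHD hI h₁ h₃).HeckeWedge10)
    (hO : ∀ (hHD : exists_isReal_hodgeModel) (hI : hodgePQ_independent_of_hodgeModel)
      (h₁ : BallQuotientUniformised) (h₃ : CMAbelianVarietyRealised),
      ∀ (F : CMField), IsGalois ℚ F → 6 ≤ Module.finrank ℚ F → ∀ (f : Face F), π f →
      ∀ (ι₁ : F →+* ℂ), f.Admissible ι₁ →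
      ∀ (V : HermSpace3 F ι₁) (Γ : Level V)
        (ω₀ ω₁ : (picardCMUniverse hHD hI h₁ h₃).CohC ((picardCMUniverse hHD hI h₁ h₃).pms F ι₁ V Γ) 1),
        ω₀ ∈ (picardCMUniverse hHD hI h₁ h₃).Uiso Γ F (f.psi 0) ι₁ →
        ω₁ ∈ (picardCMUniverse hHD hI h₁ h₃).Uiso Γ F (f.psi 1) ι₁ →
        (picardCMUniverse hHD hI h₁ h₃).cup2C ((picardCMUniverse hHD hI h₁ h₃).pms F ι₁ V Γ) 1 ω₀ ω₁ ≠ 0 →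
          ∃ (Γ' : Level V) (x : (picardCMUniverse hHD hI h₁ h₃).CohC ((picardCMUniverse hHD hI h₁ h₃).pms F ι₁ V Γ') 2),
            x ≠ 0 ∧ x ∈ (picardCMUniverse hHD hI h₁ h₃).heckeSpan Γ' Γ
              ((picardCMUniverse hHD hI h₁ h₃).cup2C ((picardCMUniverse hHD hI h₁ h₃).pms F ι₁ V Γ) 1 ω₀ ω₁) ∧
            x ∈ (picardCMUniverse hHD hI h₁ h₃).wedgeSpan Γ' F (f.psi 2) (f.psi 3) ι₁) :
    PerLFace_of_PerL :=
  fun hHD hI h₁ h₃ _ =>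
    Universe.periodThmF_of_supply_heckeWedge10_orientedOverlap
      (universeOf_fact_pull_comp hHD hI (ballQuotientUniformisedDatum_of h₁) h₃)
      (universeOf_fact_pull_hodge hHD hI (ballQuotientUniformisedDatum_of h₁) h₃)
      (universeOf_fact_cup2_hodge hHD hI (ballQuotientUniformisedDatum_of h₁) h₃)
      (universeOf_fact_pull_cup hHD hI (ballQuotientUniformisedDatum_of h₁) h₃)
      (picardCMUniverse_modelAxioms hHD hI h₁ h₃).cup_comm1 (picardCMUniverse_modelAxioms hHD hI h₁ h₃).cup_interchange
      (fun Γ η hη h0 => universeOf_hodgeRiemann_pms hHD hI (ballQuotientUniformisedDatum_of h₁) h₃ _ Γ η hη h0)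
      π hπ (hS hHD hI h₁ h₃) (hW hHD hI h₁ h₃) (hO hHD hI h₁ h₃)

/-- **Degree-6 instance of the orientation reduction.**  B01 BY NAME from B01-S, B01-H and the wedge overlap demanded only at
the faces `f` which — when `F` is a sextic field — carry a `σ²`-STABLE period type in a (12)-slot (`Face.sq_stable_slot_lt_two_or_dual`;
at other degrees every face is selected): WLOG the type induced from the imaginary quadratic subfield sits on the unconjugated diagonal. -/
theorem perLFace_of_PerL_of_supply_heckeWedge10_overlap_sqStable
    (hS : ∀ (hHD : exists_isReal_hodgeModel) (hI : hodgePQ_independent_of_hodgeModel)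
      (h₁ : BallQuotientUniformised) (h₃ : CMAbelianVarietyRealised), (picardCMUniverse hHD hI h₁ h₃).FaceSupply)
    (hW : ∀ (hHD : exists_isReal_hodgeModel) (hI : hodgePQ_independent_of_hodgeModel)
      (h₁ : BallQuotientUniformised) (h₃ : CMAbelianVarietyRealised), (picardCMUniverse hHD hI h₁ h₃).HeckeWedge10)
    (hO : ∀ (hHD : exists_isReal_hodgeModel) (hI : hodgePQ_independent_of_hodgeModel)
      (h₁ : BallQuotientUniformised) (h₃ : CMAbelianVarietyRealised),
      ∀ (F : CMField), IsGalois ℚ F → 6 ≤ Module.finrank ℚ F → ∀ (f : Face F),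
      (IsGalois ℚ F → Module.finrank ℚ F = 6 →
        ∃ (σ : F ≃ₐ[ℚ] F) (i : Fin 4), i.val < 2 ∧ orderOf σ = 6 ∧ cmTypeMap (σ ^ 2).toRingEquiv (f.psi i) = f.psi i) →
      ∀ (ι₁ : F →+* ℂ), f.Admissible ι₁ →
      ∀ (V : HermSpace3 F ι₁) (Γ : Level V)
        (ω₀ ω₁ : (picardCMUniverse hHD hI h₁ h₃).CohC ((picardCMUniverse hHD hI h₁ h₃).pms F ι₁ V Γ) 1),
        ω₀ ∈ (picardCMUniverse hHD hI h₁ h₃).Uiso Γ F (f.psi 0) ι₁ →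
        ω₁ ∈ (picardCMUniverse hHD hI h₁ h₃).Uiso Γ F (f.psi 1) ι₁ →
        (picardCMUniverse hHD hI h₁ h₃).cup2C ((picardCMUniverse hHD hI h₁ h₃).pms F ι₁ V Γ) 1 ω₀ ω₁ ≠ 0 →
          ∃ (Γ' : Level V) (x : (picardCMUniverse hHD hI h₁ h₃).CohC ((picardCMUniverse hHD hI h₁ h₃).pms F ι₁ V Γ') 2),
            x ≠ 0 ∧ x ∈ (picardCMUniverse hHD hI h₁ h₃).heckeSpan Γ' Γ
              ((picardCMUniverse hHD hI h₁ h₃).cup2C ((picardCMUniverse hHD hI h₁ h₃).pms F ι₁ V Γ) 1 ω₀ ω₁) ∧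
            x ∈ (picardCMUniverse hHD hI h₁ h₃).wedgeSpan Γ' F (f.psi 2) (f.psi 3) ι₁) :
    PerLFace_of_PerL := by
  classical
  refine perLFace_of_PerL_of_supply_heckeWedge10_orientedOverlap
    (fun F f => IsGalois ℚ F → Module.finrank ℚ F = 6 →
      ∃ (σ : F ≃ₐ[ℚ] F) (i : Fin 4), i.val < 2 ∧ orderOf σ = 6 ∧ cmTypeMap (σ ^ 2).toRingEquiv (f.psi i) = f.psi i)
    (fun F f => ?_) hS hW hO
  by_cases hG : IsGalois ℚ F
  · by_cases h6 : Module.finrank ℚ F = 6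
    · haveI := hG
      rcases Face.sq_stable_slot_lt_two_or_dual h6 f with h | h
      · exact Or.inl fun _ _ => h
      · exact Or.inr fun _ _ => h
    · exact Or.inl fun _ h => absurd h h6
  · exact Or.inl fun hG' _ => absurd hG' hG
end Model

end Summit.HodgeConjecture.CorCM

end
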